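import Literature.NumberTheory.Kottwitz1992.Involutions
import Mathlib.Analysis.Complex.Polynomial.Basic
import Mathlib.FieldTheory.Minpoly.Field
import Mathlib.Tactic.NoncommRing
import Mathlib.Tactic.Module
import HarnessLib

/-!
# [Kottwitz1992, Lemma 2.6 (1) p. 380] Hermitian forms on an irreducible module form a line — DISCHARGED:
# `Kottwitz1992_2_6_1_hermitianForms_rank_one_holds`

Kernel-lane companion of the statement carpet ★ `Literature/NumberTheory/Kottwitz1992/Involutions.lean` (squad TK; ★ `InvolutionsHolds`
pays Lemma 2.3 (1), ★ `InvolutionsLemma21Holds` Lemma 2.1): the named fact ★ `Involutions.Kottwitz1992_2_6_1_hermitianForms_rank_one` —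
«Suppose that `*` is a positive involution of `B`.  Let `V` be an irreducible `B`-module.  Then the real vector space of Hermitian forms on
`V` is one-dimensional» (typed: there is a nonzero Hermitian form `φ₀` on `V` and every Hermitian form is a real multiple of it) — is PROVED
here.  THEOREMS ONLY (no definition, no named fact, no `sorry`, no instance, no notation); cell hodgecm-mathlib, seat B-typ02 (g31); net
debt −1.

R. E. Kottwitz, *Points on some Shimura varieties over finite fields*, J. Amer. Math. Soc. 5 (1992), Lemma 2.6 (1) p. 380, proof p. 381
L4–L13 (held `paper:doi-10-2307-2152772`, p0008 L43–L44, p0009 L4–L13).  THE PRINTED PROOF: «Choose a positive definite Hermitian form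
`(x, y)₀` on `V`.  Let `(x, y)` be any Hermitian form on `V`.  Thinking of Hermitian forms on `V` as `B`-module maps from `V` to the dual of
`V`, we see that there exists a unique `B`-module endomorphism `f` of `V` such that `(v, w) = (v, fw)₀` […] Since `(x, y)` is symmetric, `f` is
a symmetric element of `End_B(V)`.  By Lemma 2.5 `f` is a real scalar.»  Formalised as printed: §1 the positive definite Hermitian form
`(x, y)₀`: the symmetrised trace form `tr_{B/ℝ}(x y*) + tr_{B/ℝ}(y x*)` on `B` (the step (4) ⇒ (5) of Lemma 2.2, p. 379 L47–L51, from the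
positivity `tr_{B/ℝ}(x x*) > 0`) pulled back along an embedding of the irreducible `V` into `B` (`B` semisimple: Mathlib
`IsSemisimpleRing.exists_linearEquiv_ideal_of_isSimpleModule`); §2 `f = ((·,·)₀)⁻¹ ∘ (·,·)` (Mathlib `LinearMap.BilinForm.toDual`) is
`B`-linear and `(·,·)₀`-symmetric, an element of the division ring `End_B(V)` (Schur, Mathlib `Module.End.instDivisionRing`); the role of
Lemma 2.5 («`f` is a real scalar») is played inline by its own argument for this one element: the minimal polynomial of `f` over `ℝ` is
irreducible (division ring), hence of degree `≤ 2` (Mathlib `Irreducible.natDegree_le_two`); degree `2`, `f² + b f + c = 0`, is impossible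
with `b² − 4c < 0` because `g = 2f + b` is symmetric with `(gv, gv)₀ = (b² − 4c)(v, v)₀ < 0`, and with `b² − 4c = s² ≥ 0` the factorisation
`(g − s)(g + s) = 0` in the division ring again makes `f` a real scalar.  (Lemma 2.5 itself, ★ `Kottwitz1992_2_5_sym_eq_real`, is neither
restated nor used here.)
HONEST LABEL: HC_CM is proved only modulo the 7 printed citations (2 remaining: hLiu418, h413) until rung 0 closes; this file adds no citation
debt (0 facts, 0 sorry) and discharges 1 named fact of ★ `Involutions`.

## References
* [Kottwitz1992] R. E. Kottwitz, Points on some Shimura varieties over finite fields, J. Amer. Math. Soc. 5 (1992) 373–444, Lemma 2.6 p. 380–381.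
-/

namespace Literature.NumberTheory.Kottwitz1992.Involutions

open Literature.NumberTheory.Automorphic (leftMulTrace leftMulTrace_apply)
open Polynomial

universe u

variable {B : Type u} [Ring B] [Algebra ℝ B] (ι : B →ₗ[ℝ] B)

/-! ## §1 The positive definite Hermitian form `(x, y)₀ = tr_{B/ℝ}(x y*) + tr_{B/ℝ}(y x*)` on `B` (Lemma 2.2, (4) ⇒ (5)) -/

omit ι in
/-- `tr_{B/ℝ}(x y) = tr_{B/ℝ}(y x)` (the trace of `L_x L_y` equals that of `L_y L_x`). [cite: Kottwitz1992, Lemma 2.2 (p. 379)] -/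
private theorem leftMulTrace_mul_comm (x y : B) : leftMulTrace ℝ B (x * y) = leftMulTrace ℝ B (y * x) := by
  rw [leftMulTrace_apply, leftMulTrace_apply, map_mul (Algebra.lmul ℝ B), map_mul (Algebra.lmul ℝ B),
    LinearMap.trace_mul_comm]

/-- **Lemma 2.2, (4) ⇒ (5) for `V = B`** (p. 379 L47–L51): if `tr_{B/ℝ}(x x*) > 0` for `x ≠ 0`, the symmetrisation
`(x, y) := tr_{B/ℝ}(x y*) + tr_{B/ℝ}(y x*)` of `(x, y)₀ = tr(x y* ; B)` «is a positive definite Hermitian form on the faithful `B`-module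
`B`». [cite: Kottwitz1992, Lemma 2.2 (p. 379)] -/
private theorem exists_posDefHermitianForm_self (hP : IsPositiveInvolution B ι) :
    ∃ Φ : LinearMap.BilinForm ℝ B, IsPosDefHermitianForm B B ι Φ := by
  have hI : IsInvolution ℝ B ι := hP.toIsInvolution
  refine ⟨LinearMap.mk₂ ℝ (fun x y => leftMulTrace ℝ B (x * ι y) + leftMulTrace ℝ B (y * ι x))
    (fun x x' y => ?_) (fun r x y => ?_) (fun x y y' => ?_) (fun r x y => ?_),
    ⟨fun x y => ?_, fun b x y => ?_⟩, fun x hx => ?_⟩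
  · simp only [map_add, add_mul, mul_add]; ring
  · simp only [map_smul, smul_mul_assoc, mul_smul_comm, smul_eq_mul]; ring
  · simp only [map_add, add_mul, mul_add]; ring
  · simp only [map_smul, smul_mul_assoc, mul_smul_comm, smul_eq_mul]; ring
  · simp only [LinearMap.mk₂_apply]; ring
  · simp only [LinearMap.mk₂_apply, smul_eq_mul, hI.map_mul, hI.apply_apply]
    have h1 : leftMulTrace ℝ B (b * x * ι y) = leftMulTrace ℝ B (x * (ι y * b)) := by
      rw [mul_assoc, leftMulTrace_mul_comm, mul_assoc]
    have h2 : leftMulTrace ℝ B (y * (ι x * ι b)) = leftMulTrace ℝ B (ι b * y * ι x) := by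
      rw [← mul_assoc, leftMulTrace_mul_comm, ← mul_assoc]
    rw [h1, h2]
  · simp only [LinearMap.mk₂_apply]
    have := hP.trace_mul_self_pos x hx
    linarith

/-! ## §2 The discharge -/

/-- **LEMMA 2.6 (1), PROVED**: ★ `Kottwitz1992_2_6_1_hermitianForms_rank_one` holds — for a positive involution `*` of the
finite-dimensional semisimple `ℝ`-algebra `B` and an irreducible `B`-module `V`, there is a nonzero Hermitian form `(·,·)₀` on `V`
(§1 pulled back along `V ↪ B`; it is positive definite) and every Hermitian form `(·,·)` is `r (·,·)₀`: `(v, w) = (v, f w)₀` for a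
`B`-linear `(·,·)₀`-symmetric `f ∈ End_B(V)`, a division ring, and `f` is a real scalar by the argument of Lemma 2.5 (minimal polynomial of
degree `≤ 2`; degree `2` contradicts positivity or factors). [cite: Kottwitz1992, Lemma 2.6 (1) (p. 380–381)] -/
theorem Kottwitz1992_2_6_1_hermitianForms_rank_one_holds : Kottwitz1992_2_6_1_hermitianForms_rank_one B ι := by
  intro hA hP V _ _ _ _ _ hV
  classical
  haveI := hV
  haveI := hA.finiteDimensional
  haveI := hA.isSemisimpleRing
  haveI : Module.Finite ℝ V := Module.Finite.trans B V
  haveI : Nontrivial V := IsSimpleModule.nontrivial B V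
  -- §1: the positive definite Hermitian form on `B`, pulled back along an embedding `V ↪ B`
  obtain ⟨Φ, hΦh, hΦpos⟩ := exists_posDefHermitianForm_self ι hP
  obtain ⟨I, ⟨e⟩⟩ := IsSemisimpleRing.exists_linearEquiv_ideal_of_isSimpleModule B V
  let g : V →ₗ[ℝ] B := (I.subtype.restrictScalars ℝ) ∘ₗ (e.toLinearMap.restrictScalars ℝ)
  have hgapply : ∀ v : V, g v = (e v : B) := fun v => rfl
  have hg : ∀ (b : B) (v : V), g (b • v) = b * g v := fun b v => by
    rw [hgapply, hgapply, map_smul, Submodule.coe_smul, smul_eq_mul]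
  have hginj : Function.Injective g := fun v w h => e.injective (Subtype.ext (by rwa [hgapply, hgapply] at h))
  let φ₀ : LinearMap.BilinForm ℝ V := Φ.comp g g
  have hφ₀ : ∀ v w, φ₀ v w = Φ (g v) (g w) := fun v w => rfl
  have h0h : IsHermitianForm B V ι φ₀ :=
    ⟨fun v w => by rw [hφ₀, hφ₀, hΦh.symm], fun b v w => by
      rw [hφ₀, hφ₀, hg, hg, ← smul_eq_mul, ← smul_eq_mul, hΦh.smul_left]⟩
  have h0pos : ∀ v : V, v ≠ 0 → 0 < φ₀ v v := fun v hv => by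
    rw [hφ₀]
    exact hΦpos _ fun h => hv (hginj (by rw [h, map_zero]))
  obtain ⟨v₁, hv₁⟩ := exists_ne (0 : V)
  refine ⟨φ₀, h0h, fun h => (h0pos v₁ hv₁).ne' (by rw [h]; rfl), fun φ hφ => ?_⟩
  -- §2: `(v, w) = (v, f w)₀` for a unique `ℝ`-linear `f` (Riesz for the nondegenerate `(·,·)₀`)
  have hnd : φ₀.Nondegenerate :=
    ⟨fun x hx => by by_contra h; exact (h0pos x h).ne' (hx x),
     fun y hy => by by_contra h; exact (h0pos y h).ne' (hy y)⟩
  let f : V →ₗ[ℝ] V := (φ₀.toDual hnd).symm.toLinearMap ∘ₗ (φ : V →ₗ[ℝ] Module.Dual ℝ V)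
  have hf : ∀ v w, φ₀ (f w) v = φ w v := fun v w => by
    rw [← LinearMap.BilinForm.toDual_def hnd]
    show φ₀.toDual hnd ((φ₀.toDual hnd).symm (φ w)) v = φ w v
    rw [LinearEquiv.apply_symm_apply]
  have hf' : ∀ v w, φ₀ v (f w) = φ v w := fun v w => by rw [h0h.symm, hf, hφ.symm]
  have hsep : ∀ x x' : V, (∀ v, φ₀ x v = φ₀ x' v) → x = x' := fun x x' h =>
    sub_eq_zero.1 (hnd.1 _ fun v => by rw [map_sub, LinearMap.sub_apply, h v, sub_self])
  -- `f` is `B`-linear («a `B`-module endomorphism») and symmetric («since `(x, y)` is symmetric»)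
  have hfB : ∀ (b : B) (w : V), f (b • w) = b • f w := fun b w =>
    hsep _ _ fun v => by rw [hf, hφ.smul_left, h0h.smul_left, hf]
  have hfsymm : ∀ v w, φ₀ (f v) w = φ₀ v (f w) := fun v w => by rw [hf, hf', hφ.symm]
  let fB : Module.End B V := { toFun := f, map_add' := f.map_add, map_smul' := hfB }
  have hfBapply : ∀ v, fB v = f v := fun v => rfl
  -- it suffices that `f` be a real scalar
  suffices hr : ∃ r : ℝ, ∀ w, f w = r • w by
    obtain ⟨r, hr⟩ := hr
    refine ⟨r, LinearMap.ext fun v => LinearMap.ext fun w => ?_⟩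
    rw [LinearMap.smul_apply, LinearMap.smul_apply, ← hf', hr, map_smul]
  -- `End_B(V)` is a division ring (Schur) finite-dimensional over `ℝ`: the minimal polynomial of `f` is irreducible of degree `≤ 2`
  have hint : IsIntegral ℝ fB := by
    have : Module.Finite ℝ (Module.End B V) :=
      Module.Finite.of_injective (LinearMap.restrictScalarsₗ ℝ B V V ℝ) (LinearMap.restrictScalars_injective ℝ)
    exact Algebra.IsIntegral.isIntegral fB
  have hirr : Irreducible (minpoly ℝ fB) := minpoly.irreducible hint
  have hmonic : (minpoly ℝ fB).Monic := minpoly.monic hint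
  have hdeg2 : (minpoly ℝ fB).natDegree ≤ 2 := hirr.natDegree_le_two
  have hdeg1 : 0 < (minpoly ℝ fB).natDegree := minpoly.natDegree_pos hint
  rcases Nat.lt_or_ge (minpoly ℝ fB).natDegree 2 with hlt | hge
  · -- degree `1`: `f` is a real scalar
    obtain ⟨r, hr⟩ := (minpoly.natDegree_eq_one_iff (A := ℝ) (x := fB)).1 (by omega)
    exact ⟨r, fun w => by rw [← hfBapply, ← hr, Module.algebraMap_end_apply]⟩
  · -- degree `2`: `f² + b f + c = 0`
    have h2 : (minpoly ℝ fB).natDegree = 2 := le_antisymm hdeg2 hge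
    have hpform : minpoly ℝ fB = X ^ 2 + C ((minpoly ℝ fB).coeff 1) * X + C ((minpoly ℝ fB).coeff 0) := by
      conv_lhs => rw [hmonic.as_sum, h2]
      simp [Finset.sum_range_succ]
      ring
    have haeval : fB * fB + (minpoly ℝ fB).coeff 1 • fB + algebraMap ℝ (Module.End B V) ((minpoly ℝ fB).coeff 0) = 0 := by
      have h := minpoly.aeval ℝ fB
      rw [hpform] at h
      simpa [pow_two, Algebra.smul_def] using h
    have hrel : ∀ v, f (f v) = -((minpoly ℝ fB).coeff 1 • f v + (minpoly ℝ fB).coeff 0 • v) := fun v => by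
      have h := congrArg (fun T : Module.End B V => T v) haeval
      simp only [LinearMap.add_apply, Module.End.mul_apply, LinearMap.smul_apply, Module.algebraMap_end_apply,
        LinearMap.zero_apply, hfBapply] at h
      rw [add_assoc] at h
      exact eq_neg_of_add_eq_zero_left h
    -- `g = 2 f + b` is symmetric with `g² = (b² − 4c)`
    have hgg : ∀ v, (2 : ℝ) • f ((2 : ℝ) • f v + (minpoly ℝ fB).coeff 1 • v) +
        (minpoly ℝ fB).coeff 1 • ((2 : ℝ) • f v + (minpoly ℝ fB).coeff 1 • v) =
        ((minpoly ℝ fB).coeff 1 ^ 2 - 4 * (minpoly ℝ fB).coeff 0) • v := fun v => by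
      rw [map_add, map_smul, map_smul, hrel]
      module
    have hgsymm : ∀ v w, φ₀ ((2 : ℝ) • f v + (minpoly ℝ fB).coeff 1 • v) w =
        φ₀ v ((2 : ℝ) • f w + (minpoly ℝ fB).coeff 1 • w) := fun v w => by
      simp only [map_add, map_smul, LinearMap.add_apply, LinearMap.smul_apply, smul_eq_mul, hfsymm]
    rcases lt_or_ge ((minpoly ℝ fB).coeff 1 ^ 2 - 4 * (minpoly ℝ fB).coeff 0) 0 with hneg | hnonneg
    · -- `b² − 4c < 0`: `(g v, g v)₀ = (b² − 4c) (v, v)₀ < 0` contradicts positivity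
      exfalso
      have hq : φ₀ ((2 : ℝ) • f v₁ + (minpoly ℝ fB).coeff 1 • v₁) ((2 : ℝ) • f v₁ + (minpoly ℝ fB).coeff 1 • v₁) =
          ((minpoly ℝ fB).coeff 1 ^ 2 - 4 * (minpoly ℝ fB).coeff 0) * φ₀ v₁ v₁ := by
        rw [hgsymm, hgg, map_smul, smul_eq_mul]
      have hnn : 0 ≤ φ₀ ((2 : ℝ) • f v₁ + (minpoly ℝ fB).coeff 1 • v₁) ((2 : ℝ) • f v₁ + (minpoly ℝ fB).coeff 1 • v₁) := by
        by_cases h0 : (2 : ℝ) • f v₁ + (minpoly ℝ fB).coeff 1 • v₁ = 0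
        · simp [h0]
        · exact (h0pos _ h0).le
      have := mul_neg_of_neg_of_pos hneg (h0pos v₁ hv₁)
      linarith
    · -- `b² − 4c = s² ≥ 0`: `(g − s)(g + s) = 0` in the division ring `End_B(V)`, so `g = ± s` and `f` is a real scalar
      set s := Real.sqrt ((minpoly ℝ fB).coeff 1 ^ 2 - 4 * (minpoly ℝ fB).coeff 0) with hs_def
      have hs : s * s = (minpoly ℝ fB).coeff 1 ^ 2 - 4 * (minpoly ℝ fB).coeff 0 := Real.mul_self_sqrt hnonneg
      let gB : Module.End B V := (2 : ℝ) • fB + algebraMap ℝ (Module.End B V) ((minpoly ℝ fB).coeff 1)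
      have hgB : ∀ w, gB w = (2 : ℝ) • f w + (minpoly ℝ fB).coeff 1 • w := fun w => by
        simp only [gB, LinearMap.add_apply, LinearMap.smul_apply, Module.algebraMap_end_apply, hfBapply]
      have hgB2 : gB * gB = algebraMap ℝ (Module.End B V) ((minpoly ℝ fB).coeff 1 ^ 2 - 4 * (minpoly ℝ fB).coeff 0) := by
        refine LinearMap.ext fun w => ?_
        rw [Module.End.mul_apply, hgB, hgB, Module.algebraMap_end_apply, map_add, map_smul, map_smul, ← hgg w, map_add,
          map_smul, map_smul]
      have hcomm : algebraMap ℝ (Module.End B V) s * gB = gB * algebraMap ℝ (Module.End B V) s := Algebra.commutes s gB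
      have hprod : (gB - algebraMap ℝ (Module.End B V) s) * (gB + algebraMap ℝ (Module.End B V) s) = 0 := by
        calc (gB - algebraMap ℝ (Module.End B V) s) * (gB + algebraMap ℝ (Module.End B V) s)
            = gB * gB - algebraMap ℝ (Module.End B V) s * algebraMap ℝ (Module.End B V) s +
                (gB * algebraMap ℝ (Module.End B V) s - algebraMap ℝ (Module.End B V) s * gB) := by noncomm_ring
          _ = 0 := by rw [hgB2, hcomm, sub_self, add_zero, ← map_mul, hs, sub_self]
      rcases mul_eq_zero.1 hprod with h0 | h0
      · refine ⟨(s - (minpoly ℝ fB).coeff 1) / 2, fun w => ?_⟩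
        have hw := congrArg (fun T : Module.End B V => T w) (sub_eq_zero.1 h0)
        simp only [hgB, Module.algebraMap_end_apply] at hw
        have h2f : (2 : ℝ) • f w = (s - (minpoly ℝ fB).coeff 1) • w := by
          rw [sub_smul, ← hw, add_sub_cancel_right]
        rw [div_eq_inv_mul, mul_smul, ← h2f, smul_smul, inv_mul_cancel₀ (two_ne_zero : (2 : ℝ) ≠ 0), one_smul]
      · refine ⟨(-s - (minpoly ℝ fB).coeff 1) / 2, fun w => ?_⟩
        have hw := congrArg (fun T : Module.End B V => T w) (eq_neg_of_add_eq_zero_left h0)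
        simp only [hgB, LinearMap.neg_apply, Module.algebraMap_end_apply] at hw
        have h2f : (2 : ℝ) • f w = (-s - (minpoly ℝ fB).coeff 1) • w := by
          rw [sub_smul, neg_smul, ← hw, add_sub_cancel_right]
        rw [div_eq_inv_mul, mul_smul, ← h2f, smul_smul, inv_mul_cancel₀ (two_ne_zero : (2 : ℝ) ≠ 0), one_smul]

end Literature.NumberTheory.Kottwitz1992.Involutions
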